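import Summits.QuantumFields.YangMills.Theorems.UnitScaleTiltProp7CornerCombLinTowerGaugeRow
import Summits.QuantumFields.YangMills.Theorems.UnitScaleTiltProp7CornerCombGaugeRowFolded
import Summits.QuantumFields.YangMills.Theorems.UnitScaleTiltProp7CornerCombCellTheoremMember
import HarnessLib

/-!
# Route `UnitScaleTilt`, crux K1 «MinimiserStabilityRegPr» (stmt-QuantumFields-19200), lane II (R-LEGS) ∕ route-R (β) (n3)-comb (II) —
# FILE F-9d-b (part 3) «THE SOURCELESS GAUGE ROW INHABITED»: the displayed `hrow₀` of ✓F-9d-a `Prop7CornerCombLinTowerCellRows.sum_cell_linTower_rows`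
# DISCHARGED for the reduced family `G^{lin}` of ANY sourceless comb tower at a unitary block-averaged tower `Ūʲ`, modulo the two LETTER DOMINATIONS `hdomG hdomM`
# (discharged in F-9d-c by CHOOSING `wG`, `wM_i` := the kernel's coefficients)

Cell `ym3-torus`, width seat `ym3-torus-px18` (gen 5); pen F-9d ≡ F-8′ ((a)(b)(c) px18 g5, ★routeR-w1 g10 12:29:20Z ∕ ★routeR-w2 g10 12:50:30Z).  THEOREMS ONLY (0 `def`,
0 `sorry`); `--supports stmt-QuantumFields-19200 --as helper`, count-neutral.  YM₃ on T³ is a ladder rung (R3), not the Clay problem; nothing here claims (hG), (hN′),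
`rlegs`, `hEng`, `hMcomb`, (β), the stub, the crux, d = 4 or the mass gap.

THE POINT.  Per level `j = k′+1 ≤ k`: ✓part 2 `gauge_row_folded` (F-6d-3′ ∘ F-8b-5a) at `V := avgIter L U₀`, `G := G^{lin}`, `Nc i := N′L^{k−i}`, `N′_top := N′L^{k−k′−1}`, top window
`w := α_{k′}` (`≤ 1∕24 ≤ 1∕8`), `V̄_{k′}(L•ẑ,κ) = Ū^{k′+1}(ẑ,κ)` (lit ✓`avgIter_succ`, `rfl`) gives `λ_{k′+1}² ≤ Σ_{i≤k′}(√L)^{k′+1−i}(cΓ·GRAD_i + cΜ_i·MASS_i + cΔ·DEF_i)`; the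
three functionals are the letters `g_i²`, `m_i²` and ✓part 1 `sum_cell_stepDefect_sq_le_sourceless` (`DEF_i ≤ (210(2d+2)L)²α_i²(2d)·m_i²`, NO source); then ✓part 1
`row_of_folded_kernel` at `s := √L = ρ⁻¹`.  CONCLUSION ★★★ `gauge_row_sourceless`: `∀ j ≤ k, λ_j² ≤ Σ_{i<j}(ρ⁻¹)^{j−i}·(wG·g_i² + wM_i·m_i²)` — ✓F-9d-a's `hrow₀` VERBATIM —
under `hdomG : cΓ ≤ wG`, `hdomM : ∀ i < k, cΜ_i + cΔ·(210(2d+2)L)²α_i²(2d) ≤ wM_i` with `cΓ cΜ_i cΔ` = ✓p717111's coefficient texts at `n := nC`, `A := AC`, `wq := α`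
WRITTEN OUT (matrix size `N`), the bond row `hbs : ‖Ūʲ⁺¹(y,ν) − Ūʲ(L•y; seg_ν L)‖ ≤ δ_j` and F-6d-3′'s cube letters `nC AC` displayed (F-9d-c reads `δ := 4α` off lit
✓`norm_bavg_sub_straight_le` and picks `nC AC` from `L`).  `𝔸 = Matrix (Fin N) (Fin N) ℂ` (forced by F-6d-3′).
HONEST SCOPE.  Assembly of landed rows; no estimate beyond ✓F-5c∕✓F-6d-3′∕✓F-8b-5a.  [folklore] bookkeeping behind [Balaban1987RG1] (0.1)∕(0.4) pp.251–253 and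
[Balaban1985Averaging] (42)–(47), Prop. 3 (122)–(126).
-/

set_option autoImplicit false

noncomputable section

open scoped BigOperators Matrix.Norms.L2Operator
open Finset

namespace Summit.QuantumFields.YangMills.Theorems.Prop7CornerCombLinTowerGaugeRowClosed

open NormedSpace
open Literature.MathematicalPhysics.QuantumFieldTheory.Balaban1983to89
open ExpMeanLog (eml)
open B7Prop1Explicit renaming Site → LSite
open B7Prop1Explicit (Letter e hol seg treeWord boxVec gammaWord plaqWord Wcx Xavg bavg expUnit U1)
open B7Prop2Explicit (avgIter avgIter_succ rescale_apply unitaryUnits unitaryUnits_le_U1)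
open B7Eq78Linearization (conjR)
open B7Prop3GeneralRotated (tsum)
open B7Prop3GeneralLinear (FhatCov)
open T4TermwiseTorus (IsPeriodic)
open Summit.QuantumFields.YangMills.Theorems.Prop7CornerCombFamiliesPeriodic (isPeriodic_sourced_families apply_add_period_of_isPeriodic
  apply_add_period_of_isPeriodic' period_tower_step)
open Summit.QuantumFields.YangMills.Theorems.Prop7CornerCombCellTheoremMember (sum_boxVec_congr avgIter_isPeriodic_level)
open Summit.QuantumFields.YangMills.Theorems.Prop7CornerCombLinTowerGaugeRow (sum_cell_stepDefect_sq_le_sourceless row_of_folded_kernel)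
open Summit.QuantumFields.YangMills.Theorems.Prop7CornerCombGaugeRowFolded (gauge_row_folded)

variable {d N : ℕ} [NeZero N]

-- hb: two ~3k-char folded rows unified per level (README HEARTBEAT BUDGET rule: decl-local, never file-global)
set_option maxHeartbeats 400000 in
/-- ★★★ **THE SOURCELESS GAUGE ROW INHABITED.**  Data (✓F-9d-a's letters at `𝔸 = Matrix (Fin N) (Fin N) ℂ`): `N′Lᵏ`-periodic unitary-valued `U₀` with unitary averaged tower
`Ūʲ` (`j ≤ k`), block loops `α_j ≤ 1∕24`, plaquettes `a_j`, the bond row `hbs` (letters `δ_j`), F-6d-3′'s cube letters `nC AC`; an `N′Lᵏ`-periodic datum `Y`; the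
SOURCELESS reduced family `G^{lin}` (`hG0 hGlin`) with its gauge function `Λ` (`hΛ0 hΛs`); the cell letters `m g lam`; `√L = ρ⁻¹`; and the letter dominations `hdomG hdomM`.
CONCLUSION: ✓F-9d-a's displayed `hrow₀` — `∀ j ≤ k, λ_j² ≤ Σ_{i<j}(ρ⁻¹)^{j−i}·(wG·g_i² + wM_i·m_i²)`.
[cite: Balaban1987RG1, (0.1), (0.4) pp.251-253; Balaban1985Averaging, (42)-(47) pp.23-25, Prop. 3 (122)-(126) p.36] -/
theorem gauge_row_sourceless (L N' k : ℕ) (hL : 2 ≤ L) (hN' : 0 < N') (U₀ : LSite d → Fin d → (Matrix (Fin N) (Fin N) ℂ)ˣ)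
    (hU₀ : IsPeriodic (N' * L ^ k) U₀)
    (hVu : ∀ j ≤ k, ∀ x μ, avgIter L U₀ j x μ ∈ unitaryUnits (Matrix (Fin N) (Fin N) ℂ))
    (α a : ℕ → ℝ) (hα24 : ∀ j < k, α j ≤ 1 / 24)
    (hα : ∀ j < k, ∀ (z : LSite d) (κ : Fin d) (r : Fin d → Fin L), ‖((Wcx L (avgIter L U₀ j) ((L : ℤ) • z) κ (boxVec L r) : (Matrix (Fin N) (Fin N) ℂ)ˣ) : Matrix (Fin N) (Fin N) ℂ) - 1‖ ≤ α j)
    (ha0 : ∀ j, 0 ≤ a j)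
    (hplaq : ∀ j < k, ∀ (x : LSite d) (κ' μ' : Fin d), κ' ≠ μ' → ‖((hol (avgIter L U₀ j) x (plaqWord κ' μ') : (Matrix (Fin N) (Fin N) ℂ)ˣ) : Matrix (Fin N) (Fin N) ℂ) - 1‖ ≤ a j)
    (δ : ℕ → ℝ) (hδ : ∀ j, 0 ≤ δ j)
    (hbs : ∀ j, j < k → ∀ (y : LSite d) (ν : Fin d), ‖((avgIter L U₀ (j + 1) y ν : (Matrix (Fin N) (Fin N) ℂ)ˣ) : Matrix (Fin N) (Fin N) ℂ)
      - ((hol (avgIter L U₀ j) ((L : ℤ) • y) (seg ν (L : ℤ)) : (Matrix (Fin N) (Fin N) ℂ)ˣ) : Matrix (Fin N) (Fin N) ℂ)‖ ≤ δ j)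
    (nC AC : ℕ) (hnC : L * L + L ≤ nC + 1) (hnA : nC + 1 ≤ AC * (L * L))
    (Y : LSite d → Fin d → Matrix (Fin N) (Fin N) ℂ) (hYper : IsPeriodic (N' * L ^ k) Y)
    (Glin : ℕ → LSite d → Fin d → Matrix (Fin N) (Fin N) ℂ) (Λ : ℕ → LSite d → Matrix (Fin N) (Fin N) ℂ)
    (hG0 : Glin 0 = Y) (hΛ0 : ∀ z, Λ 0 z = 0)
    (hGlin : ∀ (j : ℕ) (z : LSite d) (κ : Fin d), Glin (j + 1) z κ
      = (fderiv ℂ (eml : ((Fin d → Fin L) → Matrix (Fin N) (Fin N) ℂ) → Matrix (Fin N) (Fin N) ℂ) (fun r => ((Wcx L (avgIter L U₀ j) ((L : ℤ) • z) κ (boxVec L r) : (Matrix (Fin N) (Fin N) ℂ)ˣ) : Matrix (Fin N) (Fin N) ℂ))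
            (fun r => tsum (avgIter L U₀ j) (Glin j) ((L : ℤ) • z) (gammaWord L κ (boxVec L r) ++ seg κ (-(L : ℤ)))
              * ((Wcx L (avgIter L U₀ j) ((L : ℤ) • z) κ (boxVec L r) : (Matrix (Fin N) (Fin N) ℂ)ˣ) : Matrix (Fin N) (Fin N) ℂ))
            * (((expUnit (Xavg L (avgIter L U₀ j) ((L : ℤ) • z) κ))⁻¹ : (Matrix (Fin N) (Fin N) ℂ)ˣ) : Matrix (Fin N) (Fin N) ℂ)
          + ((expUnit (Xavg L (avgIter L U₀ j) ((L : ℤ) • z) κ) : (Matrix (Fin N) (Fin N) ℂ)ˣ) : Matrix (Fin N) (Fin N) ℂ) * tsum (avgIter L U₀ j) (Glin j) ((L : ℤ) • z) (seg κ (L : ℤ))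
            * (((expUnit (Xavg L (avgIter L U₀ j) ((L : ℤ) • z) κ))⁻¹ : (Matrix (Fin N) (Fin N) ℂ)ˣ) : Matrix (Fin N) (Fin N) ℂ))
        - (FhatCov L (avgIter L U₀ j) (Glin j) ((L : ℤ) • z) - conjR (avgIter L U₀ (j + 1) z κ) (FhatCov L (avgIter L U₀ j) (Glin j) ((L : ℤ) • (z + e κ)))))
    (hΛs : ∀ (j : ℕ) (z : LSite d), Λ (j + 1) z = FhatCov L (avgIter L U₀ j) (Glin j) ((L : ℤ) • z) + Λ j ((L : ℤ) • z))
    (m g lam : ℕ → ℝ)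
    (hm : ∀ j, m j = Real.sqrt (∑ t : Fin d → Fin (N' * L ^ (k - j)), ∑ μ' : Fin d, ‖Glin j (boxVec (N' * L ^ (k - j)) t) μ'‖ ^ 2))
    (hg : ∀ j, g j = Real.sqrt (∑ t : Fin d → Fin (N' * L ^ (k - j)), ∑ κ : Fin d, ∑ ν : Fin d,
      ‖conjR (avgIter L U₀ j (boxVec (N' * L ^ (k - j)) t) ν) (Glin j (boxVec (N' * L ^ (k - j)) t + e ν) κ) - Glin j (boxVec (N' * L ^ (k - j)) t) κ‖ ^ 2))
    (hlam : ∀ j, lam j = Real.sqrt (∑ t : Fin d → Fin (N' * L ^ (k - j)), ∑ κ : Fin d,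
      ‖Λ j (boxVec (N' * L ^ (k - j)) t) - conjR (avgIter L U₀ j (boxVec (N' * L ^ (k - j)) t) κ) (Λ j (boxVec (N' * L ^ (k - j)) t + e κ))‖ ^ 2))
    {ρ : ℝ} (hρs : Real.sqrt (L : ℝ) = ρ⁻¹) {wG : ℝ} (wM : ℕ → ℝ)
    (hdomG : 3 * ((Real.sqrt L)⁻¹ * ((d : ℝ) * ((L : ℝ) ^ 2 / 4) * (2 * ((L : ℝ) ^ d)⁻¹ * (L : ℝ) * (L : ℝ)))
              + (L : ℝ)⁻¹ * (2 * (d : ℝ) * (1 - (Real.sqrt L)⁻¹)⁻¹ * ((L : ℝ) ^ 2 / 4) * 2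
                  * (((L : ℝ) ^ d)⁻¹ * (3 * N * ((nC : ℝ) + 1) ^ 2 * ((d : ℝ) * ((d : ℝ) * (AC : ℝ) ^ d)))))
              + (Real.sqrt L)⁻¹ * (2 * (1 - (Real.sqrt L)⁻¹)⁻¹ * 2 * (N / 2 * (d : ℝ) ^ 2 * ((L : ℝ) - 1) ^ 2 * (L : ℝ) ^ 2 * (d : ℝ)))) ≤ wG)
    (hdomM : ∀ i < k, 3 * ((Real.sqrt L)⁻¹ * ((d : ℝ) * ((L : ℝ) ^ 2 / 4) * (2 * ((L : ℝ) ^ d)⁻¹ * (8 * (((d : ℝ) + 1) * (L : ℝ)) ^ 2 * a i + 8 * α i) ^ 2 * (d : ℝ)))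
              + (L : ℝ)⁻¹ * (2 * (d : ℝ) * (1 - (Real.sqrt L)⁻¹)⁻¹ * ((L : ℝ) ^ 2 / 4) * 2
                  * (((L : ℝ) ^ d)⁻¹ * ((12 * N * ((nC : ℝ) + 1) ^ 2 * (d : ℝ) ^ 3 * (nC : ℝ) ^ 2 * a i ^ 2
                      + 3 * (2 * d * L * δ i + 2 * ((3 * d + 1) * nC : ℝ) ^ 2 * a i) ^ 2) * ((d : ℝ) * ((d : ℝ) * (AC : ℝ) ^ d)))))
              + (Real.sqrt L)⁻¹ * (2 * (1 - (Real.sqrt L)⁻¹)⁻¹ * 2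
                  * ((8 * (d : ℝ) ^ 6 * ((L : ℝ) - 1) ^ 6 + 2 * N * (d : ℝ) ^ 5 * ((L : ℝ) - 1) ^ 4 * (L : ℝ) ^ 2) * a i ^ 2 * (d : ℝ))))
        + 3 * ((L : ℝ)⁻¹ * (2 * (d : ℝ) * (1 - (Real.sqrt L)⁻¹)⁻¹ * ((L : ℝ) ^ 2 / 4) * 2 * (3 * ((L : ℝ) ^ 2)⁻¹ * ((L : ℝ) ^ d)⁻¹ * (d : ℝ))))
          * ((210 * ((2 * d + 2) * L)) ^ 2 * α i ^ 2 * (2 * d)) ≤ wM i) :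
    ∀ j ≤ k, lam j ^ 2 ≤ ∑ i ∈ Finset.range j, (ρ⁻¹) ^ (j - i) * (wG * g i ^ 2 + wM i * m i ^ 2) := by
  letI : CStarAlgebra (Matrix (Fin N) (Fin N) ℂ) := {}
  -- periods
  set Nc : ℕ → ℕ := fun j => N' * L ^ (k - j) with hNc
  have hL1 : 1 ≤ L := le_trans (by norm_num) hL
  have hL0 : 0 < L := hL1
  have hNc0 : ∀ j, 0 < Nc j := fun j => by simp only [hNc]; positivity
  have hNcs : ∀ j < k, Nc j = Nc (j + 1) * L := fun j hj => by simp only [hNc]; exact period_tower_step N' L k j hj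
  -- periodicity (✓F-8a, ✓F-8b-1 at `rem := 0`)
  have hVper : ∀ j ≤ k, IsPeriodic (Nc j) (avgIter L U₀ j) := fun j hj => avgIter_isPeriodic_level L N' k hU₀ hj
  have hGlper : ∀ j ≤ k, IsPeriodic (Nc j) (Glin j) ∧ IsPeriodic (Nc j) (Λ j) :=
    isPeriodic_sourced_families L Nc k hNcs (fun j => avgIter L U₀ j) hVper (fun _ _ _ => 0) (fun _ _ _ _ => rfl) Glin Λ
      (by rw [hG0]; exact hYper) hΛ0 (fun j z κ => by rw [hGlin, add_zero]) hΛs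
  have hcoord : ∀ {X : LSite d → Fin d → Matrix (Fin N) (Fin N) ℂ} {j : ℕ}, j < k → IsPeriodic (Nc j) X →
      ∀ (x : LSite d) (κ μ' : Fin d), X (x + ((Nc (j + 1) * L : ℕ) : ℤ) • e κ) μ' = X x μ' := by
    intro X j hj hX x κ μ'
    rw [← hNcs j hj]; exact apply_add_period_of_isPeriodic hX x κ μ'
  -- nonnegativity and the three cell functionals as letters
  have hm0' : ∀ j, 0 ≤ m j := fun j => by rw [hm]; exact Real.sqrt_nonneg _
  have hg0' : ∀ j, 0 ≤ g j := fun j => by rw [hg]; exact Real.sqrt_nonneg _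
  have hlam0 : lam 0 = 0 := by
    rw [hlam]
    simp [hΛ0, B7Eq78Linearization.conjR_apply]
  have hΓ : ∀ i < k, (∑ y : Fin d → Fin (Nc i), ∑ μ : Fin d, ∑ ν : Fin d,
      ‖conjR (avgIter L U₀ i (boxVec (Nc i) y) ν) (Glin i (boxVec (Nc i) y + e ν) μ) - Glin i (boxVec (Nc i) y) μ‖ ^ 2) = g i ^ 2 := by
    intro i _
    rw [hg, Real.sq_sqrt (Finset.sum_nonneg fun _ _ => Finset.sum_nonneg fun _ _ => Finset.sum_nonneg fun _ _ => sq_nonneg _)]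
  have hΜ : ∀ i < k, (∑ y : Fin d → Fin (Nc i), ∑ μ : Fin d, ‖Glin i (boxVec (Nc i) y) μ‖ ^ 2) = m i ^ 2 := by
    intro i _
    rw [hm, Real.sq_sqrt (Finset.sum_nonneg fun _ _ => Finset.sum_nonneg fun _ _ => sq_nonneg _)]
  have hΔ : ∀ i < k, (∑ μ : Fin d, ∑ y : Fin d → Fin (Nc (i + 1)),
      ‖Glin (i + 1) (boxVec (Nc (i + 1)) y) μ
        - ∑ r : Fin d → Fin L, ∑ t ∈ Finset.range L, (((L : ℝ) ^ d)⁻¹) •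
            conjR (hol (avgIter L U₀ i) ((L : ℤ) • boxVec (Nc (i + 1)) y) (treeWord (boxVec L r) ++ seg μ (t : ℤ)))
              (Glin i ((L : ℤ) • boxVec (Nc (i + 1)) y + boxVec L r + (t : ℤ) • e μ) μ)‖ ^ 2)
      ≤ ((210 * ((2 * d + 2) * L)) ^ 2 * α i ^ 2 * (2 * d)) * (∑ y : Fin d → Fin (Nc i), ∑ μ : Fin d, ‖Glin i (boxVec (Nc i) y) μ‖ ^ 2) := by
    intro i hi
    haveI : NeZero (Nc (i + 1)) := ⟨(hNc0 (i + 1)).ne'⟩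
    have h := sum_cell_stepDefect_sq_le_sourceless L (Nc (i + 1)) hL1 U₀ i (hVu i hi.le) (Glin i) (Glin (i + 1)) (hcoord hi (hGlper i hi.le).1)
      (hα24 i hi) (fun z κ r => hα i hi _ κ r) (hGlin i)
    rw [sum_boxVec_congr (hNcs i hi).symm (fun x => ∑ ν : Fin d, ‖Glin i x ν‖ ^ 2)] at h
    exact h
  -- ★ the folded row at every level `k' + 1 ≤ k`
  have hfold : ∀ k' < k, lam (k' + 1) ^ 2 ≤ ∑ i ∈ Finset.range (k' + 1), (Real.sqrt (L : ℝ)) ^ (k' + 1 - i) *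
      (3 * ((Real.sqrt L)⁻¹ * ((d : ℝ) * ((L : ℝ) ^ 2 / 4) * (2 * ((L : ℝ) ^ d)⁻¹ * (L : ℝ) * (L : ℝ)))
              + (L : ℝ)⁻¹ * (2 * (d : ℝ) * (1 - (Real.sqrt L)⁻¹)⁻¹ * ((L : ℝ) ^ 2 / 4) * 2
                  * (((L : ℝ) ^ d)⁻¹ * (3 * N * ((nC : ℝ) + 1) ^ 2 * ((d : ℝ) * ((d : ℝ) * (AC : ℝ) ^ d)))))
              + (Real.sqrt L)⁻¹ * (2 * (1 - (Real.sqrt L)⁻¹)⁻¹ * 2 * (N / 2 * (d : ℝ) ^ 2 * ((L : ℝ) - 1) ^ 2 * (L : ℝ) ^ 2 * (d : ℝ))))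
        * (∑ y : Fin d → Fin (Nc i), ∑ μ : Fin d, ∑ ν : Fin d,
            ‖conjR (avgIter L U₀ i (boxVec (Nc i) y) ν) (Glin i (boxVec (Nc i) y + e ν) μ) - Glin i (boxVec (Nc i) y) μ‖ ^ 2)
      + 3 * ((Real.sqrt L)⁻¹ * ((d : ℝ) * ((L : ℝ) ^ 2 / 4) * (2 * ((L : ℝ) ^ d)⁻¹ * (8 * (((d : ℝ) + 1) * (L : ℝ)) ^ 2 * a i + 8 * α i) ^ 2 * (d : ℝ)))
              + (L : ℝ)⁻¹ * (2 * (d : ℝ) * (1 - (Real.sqrt L)⁻¹)⁻¹ * ((L : ℝ) ^ 2 / 4) * 2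
                  * (((L : ℝ) ^ d)⁻¹ * ((12 * N * ((nC : ℝ) + 1) ^ 2 * (d : ℝ) ^ 3 * (nC : ℝ) ^ 2 * a i ^ 2
                      + 3 * (2 * d * L * δ i + 2 * ((3 * d + 1) * nC : ℝ) ^ 2 * a i) ^ 2) * ((d : ℝ) * ((d : ℝ) * (AC : ℝ) ^ d)))))
              + (Real.sqrt L)⁻¹ * (2 * (1 - (Real.sqrt L)⁻¹)⁻¹ * 2
                  * ((8 * (d : ℝ) ^ 6 * ((L : ℝ) - 1) ^ 6 + 2 * N * (d : ℝ) ^ 5 * ((L : ℝ) - 1) ^ 4 * (L : ℝ) ^ 2) * a i ^ 2 * (d : ℝ))))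
        * (∑ y : Fin d → Fin (Nc i), ∑ μ : Fin d, ‖Glin i (boxVec (Nc i) y) μ‖ ^ 2)
      + 3 * ((L : ℝ)⁻¹ * (2 * (d : ℝ) * (1 - (Real.sqrt L)⁻¹)⁻¹ * ((L : ℝ) ^ 2 / 4) * 2 * (3 * ((L : ℝ) ^ 2)⁻¹ * ((L : ℝ) ^ d)⁻¹ * (d : ℝ))))
        * (∑ μ : Fin d, ∑ y : Fin d → Fin (Nc (i + 1)),
            ‖Glin (i + 1) (boxVec (Nc (i + 1)) y) μ
              - ∑ r : Fin d → Fin L, ∑ t ∈ Finset.range L, (((L : ℝ) ^ d)⁻¹) •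
                  conjR (hol (avgIter L U₀ i) ((L : ℤ) • boxVec (Nc (i + 1)) y) (treeWord (boxVec L r) ++ seg μ (t : ℤ)))
                    (Glin i ((L : ℤ) • boxVec (Nc (i + 1)) y + boxVec L r + (t : ℤ) • e μ) μ)‖ ^ 2)) := by
    intro k' hk'
    haveI : NeZero (Nc (k' + 1)) := ⟨(hNc0 (k' + 1)).ne'⟩
    have hNc' : ∀ i, i ≤ k' + 1 → Nc i = Nc (k' + 1) * L ^ (k' + 1 - i) := by
      intro i hi
      simp only [hNc]
      rw [mul_assoc, ← pow_add]; congr 2; omega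
    have hF := gauge_row_folded L hL nC AC hnC hnA k' (Nc (k' + 1)) Nc hNc' (fun i => avgIter L U₀ i)
      (fun i hi x μ => unitaryUnits_le_U1 (hVu i (by omega) x μ))
      (fun i hi x μ ι => apply_add_period_of_isPeriodic (hVper i (by omega)) x ι μ)
      a ha0 (fun i hi x μ ν hμν => hplaq i (by omega) x μ ν hμν) δ hδ (fun j hj y ν => hbs j (by omega) y ν) α
      (fun z₀ κ r => hα k' hk' _ κ r) ((hα24 k' hk').trans (by norm_num))
      (fun z₀ κ => unitaryUnits_le_U1 (hVu (k' + 1) (by omega) (boxVec (Nc (k' + 1)) z₀) κ))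
      Glin (fun i hi x μ ι => apply_add_period_of_isPeriodic (hGlper i (by omega)).1 x ι μ) Λ hΛ0 (fun i _ y => hΛs i y)
    have hlamsq : lam (k' + 1) ^ 2 = ∑ z₀ : Fin d → Fin (Nc (k' + 1)), ∑ κ : Fin d,
        ‖Λ (k' + 1) (boxVec (Nc (k' + 1)) z₀) - conjR (bavg L (avgIter L U₀ k') ((L : ℤ) • boxVec (Nc (k' + 1)) z₀) κ) (Λ (k' + 1) (boxVec (Nc (k' + 1)) z₀ + e κ))‖ ^ 2 := by
      rw [hlam, Real.sq_sqrt (Finset.sum_nonneg fun _ _ => Finset.sum_nonneg fun _ _ => sq_nonneg _)]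
      rfl
    rw [hlamsq]
    exact hF
  -- ★ kernel-to-row (✓part 1) at `s := √L = ρ⁻¹`
  have hs : 0 < Real.sqrt (L : ℝ) := Real.sqrt_pos.mpr (by exact_mod_cast hL0)
  have hsL : 1 < Real.sqrt (L : ℝ) := by
    have h2 : (1 : ℝ) < (L : ℝ) := by exact_mod_cast (lt_of_lt_of_le (by norm_num) hL)
    have := Real.sqrt_lt_sqrt (by norm_num) h2
    rwa [Real.sqrt_one] at this
  have hι : 0 ≤ (1 - (Real.sqrt (L : ℝ))⁻¹)⁻¹ := inv_nonneg.mpr (sub_pos.mpr (inv_lt_one_of_one_lt₀ hsL)).le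
  have hcD : 0 ≤ 3 * ((L : ℝ)⁻¹ * (2 * (d : ℝ) * (1 - (Real.sqrt L)⁻¹)⁻¹ * ((L : ℝ) ^ 2 / 4) * 2 * (3 * ((L : ℝ) ^ 2)⁻¹ * ((L : ℝ) ^ d)⁻¹ * (d : ℝ)))) := by
    refine mul_nonneg (by norm_num) (mul_nonneg (by positivity) (mul_nonneg ?_ (by positivity)))
    refine mul_nonneg (mul_nonneg (mul_nonneg (by positivity) hι) (by positivity)) (by norm_num)
  have key := row_of_folded_kernel (s := Real.sqrt (L : ℝ)) (cΓ := 3 * ((Real.sqrt L)⁻¹ * ((d : ℝ) * ((L : ℝ) ^ 2 / 4) * (2 * ((L : ℝ) ^ d)⁻¹ * (L : ℝ) * (L : ℝ)))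
              + (L : ℝ)⁻¹ * (2 * (d : ℝ) * (1 - (Real.sqrt L)⁻¹)⁻¹ * ((L : ℝ) ^ 2 / 4) * 2
                  * (((L : ℝ) ^ d)⁻¹ * (3 * N * ((nC : ℝ) + 1) ^ 2 * ((d : ℝ) * ((d : ℝ) * (AC : ℝ) ^ d)))))
              + (Real.sqrt L)⁻¹ * (2 * (1 - (Real.sqrt L)⁻¹)⁻¹ * 2 * (N / 2 * (d : ℝ) ^ 2 * ((L : ℝ) - 1) ^ 2 * (L : ℝ) ^ 2 * (d : ℝ))))) (cΔ := 3 * ((L : ℝ)⁻¹ * (2 * (d : ℝ) * (1 - (Real.sqrt L)⁻¹)⁻¹ * ((L : ℝ) ^ 2 / 4) * 2 * (3 * ((L : ℝ) ^ 2)⁻¹ * ((L : ℝ) ^ d)⁻¹ * (d : ℝ))))) (wG := wG) hs hcD (k := k) g m lam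
    (fun i => ∑ y : Fin d → Fin (Nc i), ∑ μ : Fin d, ∑ ν : Fin d,
        ‖conjR (avgIter L U₀ i (boxVec (Nc i) y) ν) (Glin i (boxVec (Nc i) y + e ν) μ) - Glin i (boxVec (Nc i) y) μ‖ ^ 2)
    (fun i => ∑ y : Fin d → Fin (Nc i), ∑ μ : Fin d, ‖Glin i (boxVec (Nc i) y) μ‖ ^ 2)
    (fun i => ∑ μ : Fin d, ∑ y : Fin d → Fin (Nc (i + 1)),
        ‖Glin (i + 1) (boxVec (Nc (i + 1)) y) μ
          - ∑ r : Fin d → Fin L, ∑ t ∈ Finset.range L, (((L : ℝ) ^ d)⁻¹) •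
              conjR (hol (avgIter L U₀ i) ((L : ℤ) • boxVec (Nc (i + 1)) y) (treeWord (boxVec L r) ++ seg μ (t : ℤ)))
                (Glin i ((L : ℤ) • boxVec (Nc (i + 1)) y + boxVec L r + (t : ℤ) • e μ) μ)‖ ^ 2)
    (fun i => (210 * ((2 * d + 2) * L)) ^ 2 * α i ^ 2 * (2 * d))
    (fun i => 3 * ((Real.sqrt L)⁻¹ * ((d : ℝ) * ((L : ℝ) ^ 2 / 4) * (2 * ((L : ℝ) ^ d)⁻¹ * (8 * (((d : ℝ) + 1) * (L : ℝ)) ^ 2 * a i + 8 * α i) ^ 2 * (d : ℝ)))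
              + (L : ℝ)⁻¹ * (2 * (d : ℝ) * (1 - (Real.sqrt L)⁻¹)⁻¹ * ((L : ℝ) ^ 2 / 4) * 2
                  * (((L : ℝ) ^ d)⁻¹ * ((12 * N * ((nC : ℝ) + 1) ^ 2 * (d : ℝ) ^ 3 * (nC : ℝ) ^ 2 * a i ^ 2
                      + 3 * (2 * d * L * δ i + 2 * ((3 * d + 1) * nC : ℝ) ^ 2 * a i) ^ 2) * ((d : ℝ) * ((d : ℝ) * (AC : ℝ) ^ d)))))
              + (Real.sqrt L)⁻¹ * (2 * (1 - (Real.sqrt L)⁻¹)⁻¹ * 2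
                  * ((8 * (d : ℝ) ^ 6 * ((L : ℝ) - 1) ^ 6 + 2 * N * (d : ℝ) ^ 5 * ((L : ℝ) - 1) ^ 4 * (L : ℝ) ^ 2) * a i ^ 2 * (d : ℝ)))))
    wM hlam0 hΓ hΜ hΔ hdomG hdomM hfold
  intro j hj
  rw [← hρs]
  exact key j hj

end Summit.QuantumFields.YangMills.Theorems.Prop7CornerCombLinTowerGaugeRowClosed

end
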